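import Literature.NumberTheory.Sieve.MatomakiRadziwill
import Literature.NumberTheory.LFunctions.DirichletPolynomialMeanValue
import Mathlib.Analysis.SpecialFunctions.Integrals.Basic
import Mathlib.MeasureTheory.Function.Floor
import Mathlib.Analysis.Calculus.MeanValue
import HarnessLib

/-!
# Matomäki–Radziwiłł 2016, Lemma 14: the complex-sequence rendering is false

Topic `NumberTheory/Sieve`.  The file `MatomakiRadziwill.lean` records Lemma 14 of Matomäki–Radziwiłł
(*Multiplicative functions in short intervals*, Ann. of Math. 183 (2016), §7, "Parseval bound") three
times: `MatomakiRadziwill2016_lemma14` (mis-parenthesised), `MatomakiRadziwill2016_lemma14_parseval`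
(correctly parenthesised) — both quantifying over **complex** sequences `a : ℕ → ℂ` — and the faithful
real-sequence rendering `MatomakiRadziwill2016_lemma14_real`, which is PROVED in
`MatomakiRadziwillLemma14.lean`.  This file **proves the negation** of the complex-sequence rendering:

* `MatomakiRadziwill2016_lemma14_parseval_false : ¬ MatomakiRadziwill2016_lemma14_parseval`.

So the named fact `MatomakiRadziwill2016_lemma14_parseval` can never be discharged; it is an
over-generalisation of the printed lemma ("Let `|a_m| ≤ 1`", a real sequence in the paper: the proof
splits the Perron integral at `|t| = T₀` and then displays only `t ≥ T₀`, using `|A(1-it)| = |A(1+it)|`),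
not a defect of the paper.  Since the 2026-08-15 verdict clean-up that def is `@[deprecated]` in
`MatomakiRadziwill.lean` (statement kept verbatim as the subject of this refutation); the refutation
must name it, so the deprecation linter is silenced on exactly the two declarations below that do
(`MatomakiRadziwill2016_lemma14_parseval_false` and its conventional alias
`not_MatomakiRadziwill2016_lemma14_parseval`).

## The counterexample

For a parameter `M ≥ 32` (chosen `≥ X₀` and `≥ 100 max(C,1)` against purported constants `C, X₀`) put
`X = exp(M¹⁵)`, so that `(log X)^{1/15} = M`, `(log X)^{1/5} = M³`, `(log X)^{2/15} = M²`, and take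
`a_m = m^{-iM⁴}` (`twist`), `h₁ = X/M⁵` (so `X/h₁ = M⁵`), `h₂ = X/(log X)^{1/5} = X/M³`.

* *Dirichlet polynomial.*  `A(1+it) = ∑_{X≤m≤4X} a_m m^{-1-it} = D(t + M⁴)` with
  `D(u) = ∑_{X≤m≤4X} m^{-1-iu}` (`Dsum`, `sum_twist_mul_cpow`), and comparing the sum with
  `∫ y^{-1-iu} dy = O(1/u)` gives `|D(u)| ≤ 2/u + 4(1+u)/X` for `u > 0` (`norm_Dsum_le`).  Hence the
  integral term `∫_{M}^{M⁵} |A|² ≤ 9/M` (`integral_term_le`, `integral_bound_le`) and the `max` term is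
  `≤ 12/M` (`iSup_max_term_le`, `max_bound_le`: the pointwise bound for `T ≤ √X`, and for `T ≥ √X` the
  weak mean value theorem `Literature.NumberTheory.LFunctions.dirichletPolynomial_meanSquare_le`,
  `∫_{-V}^{V}|D|² ≤ (5V + 18·4X)(4/X)`, `integral_norm_Dsum_sq_le`).  With `(log X)^{-2/15} = 1/M²` the
  right-hand side is `≤ 22 C/M < 1/4`.
* *Short sums.*  `S_j(x) = ∑_{x≤m≤x+h_j} m^{-iM⁴}` (`Ssum`): the phase is nearly constant on
  `[x, x+h₁]` (`M⁴h₁/X = 1/M`), so `|S₁(x)|/h₁ ≥ 1 - 2/M` (`card_mul_le_norm_Ssum`), while over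
  `[x, x+h₂]` it cancels, `|S₂(x)|/h₂ ≤ 7M³/M⁴ + O(M⁷/X) ≤ 9/M` (`norm_Ssum_le`, again sum versus
  integral).  Hence `|S₁/h₁ - S₂/h₂|² ≥ 1/4` on `[X, 2X]` and the left-hand side is `≥ 1/4`
  (`lhs_ge_quarter`; the integrand is a bounded measurable step function, `intervalIntegrable_lhsFun`).

All constants are explicit; the only analysis used is the mean value inequality for `y ↦ y^w`
(`norm_ofReal_cpow_sub_le`), `∫ y^w = y^{w+1}/(w+1)` (`integral_cpow`), a sum-versus-integral
comparison (`norm_sum_Icc_sub_integral_le`), and the proved weak mean value theorem.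

## What is not here

The mis-parenthesised rendering `MatomakiRadziwill2016_lemma14` (whose `max` term carries the extra
factor `X/h₁ - (log X)^{1/15}`) is not refuted by this particular family (that factor times the `max`
term is not small here); a smoothly weighted variant of the same twist would be needed.

## References

* K. Matomäki, M. Radziwiłł, *Multiplicative functions in short intervals*, Ann. of Math. (2) 183
  (2016), 1015–1056, doi:10.4007/annals.2016.183.3.6 (arXiv:1501.04585): §7, Lemma 14 and its proof
  (arXiv p. 15: "according to whether `|t| ≤ T₀` or not", then only `∫_{1+iT₀}^{1+i∞}` is displayed).
* A. Ivić, *The Riemann zeta-function* (1985), Thm 5.2 (the mean value theorem; weak form proved in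
  `DirichletPolynomialMeanValue.lean`).
-/

open Finset Real Complex MeasureTheory Set

namespace Literature.NumberTheory.Sieve

namespace MatomakiRadziwillL14C

/-! ### Calculus: `y ↦ y^w` on `[X, ∞)` and sums versus integrals -/

/-- Lipschitz bound for `y ↦ y^w` on `[X, ∞)`, `X > 0`, when `Re w ≤ 1`:
`|z^w - y^w| ≤ |w| X^{Re w - 1} |z - y|`. [folklore] -/
theorem norm_ofReal_cpow_sub_le {w : ℂ} (hw : w ≠ 0) (hre : w.re ≤ 1) {X y z : ℝ} (hX : 0 < X)
    (hy : X ≤ y) (hz : X ≤ z) :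
    ‖(z : ℂ) ^ w - (y : ℂ) ^ w‖ ≤ ‖w‖ * X ^ (w.re - 1) * |z - y| := by
  have key := Convex.norm_image_sub_le_of_norm_hasDerivWithin_le
    (f := fun t : ℝ => (t : ℂ) ^ w) (f' := fun t : ℝ => w * (t : ℂ) ^ (w - 1)) (s := Set.Ici X)
    (C := ‖w‖ * X ^ (w.re - 1)) (x := y) (y := z) ?_ ?_ (convex_Ici X) hy hz
  · simpa only [Real.norm_eq_abs] using key
  · intro t ht
    exact (hasDerivAt_ofReal_cpow_const (hX.trans_le ht).ne' hw).hasDerivWithinAt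
  · intro t ht
    have ht0 : 0 < t := hX.trans_le ht
    rw [norm_mul, Complex.norm_cpow_eq_rpow_re_of_pos ht0, Complex.sub_re, Complex.one_re]
    exact mul_le_mul_of_nonneg_left (Real.rpow_le_rpow_of_nonpos hX ht (by linarith))
      (norm_nonneg _)

/-- **Sums versus integrals** for a vector-valued function: if `‖f y - f(c+k)‖ ≤ K` on each
`[c+k, c+k+1]`, `k < n`, and `f` is continuous on `[c, c+n]`, then
`‖∑_{k<n} f(c+k) - ∫_c^{c+n} f‖ ≤ n K`. [folklore] -/
theorem norm_sum_range_sub_integral_le {f : ℝ → ℂ} {c : ℝ} {n : ℕ} {K : ℝ}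
    (hcont : ContinuousOn f (Set.Icc c (c + n)))
    (hlip : ∀ k : ℕ, k < n → ∀ y ∈ Set.Icc (c + k) (c + k + 1), ‖f y - f (c + k)‖ ≤ K) :
    ‖∑ k ∈ Finset.range n, f (c + k) - ∫ y in c..c + n, f y‖ ≤ n * K := by
  have hint : ∀ k < n, IntervalIntegrable f volume (c + k) (c + (k + 1 : ℕ)) := by
    intro k hk
    refine ContinuousOn.intervalIntegrable_of_Icc (by push_cast; linarith) (hcont.mono ?_)
    intro y hy
    have hkn : (k : ℝ) + 1 ≤ n := by exact_mod_cast hk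
    have hk0 : (0 : ℝ) ≤ k := Nat.cast_nonneg k
    push_cast at hy
    exact ⟨by linarith [hy.1], by linarith [hy.2]⟩
  have hsplit := intervalIntegral.sum_integral_adjacent_intervals (f := f) (μ := volume)
    (a := fun k : ℕ => c + k) (n := n) (by intro k hk; exact hint k hk)
  simp only [Nat.cast_zero, add_zero] at hsplit
  rw [← hsplit, ← Finset.sum_sub_distrib]
  calc ‖∑ k ∈ Finset.range n, (f (c + k) - ∫ y in (c + k)..(c + (k + 1 : ℕ)), f y)‖
      ≤ ∑ k ∈ Finset.range n, ‖f (c + k) - ∫ y in (c + k)..(c + (k + 1 : ℕ)), f y‖ :=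
        norm_sum_le _ _
    _ ≤ ∑ k ∈ Finset.range n, K := by
        refine Finset.sum_le_sum fun k hk => ?_
        rw [Finset.mem_range] at hk
        have e : f (c + k) - ∫ y in (c + k)..(c + (k + 1 : ℕ)), f y
            = ∫ y in (c + k)..(c + (k + 1 : ℕ)), (f (c + k) - f y) := by
          rw [intervalIntegral.integral_sub intervalIntegrable_const (hint k hk),
            intervalIntegral.integral_const]
          push_cast
          rw [show c + (k + 1 : ℝ) - (c + k) = 1 by ring, one_smul]
        rw [e]
        have := intervalIntegral.norm_integral_le_of_norm_le_const (a := c + k)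
          (b := c + (k + 1 : ℕ)) (f := fun y => f (c + k) - f y) (C := K) ?_
        · push_cast at this ⊢
          rwa [show c + (k + 1 : ℝ) - (c + k) = 1 by ring, abs_one, mul_one] at this
        · intro y hy
          have hk1 : (c + k : ℝ) ≤ c + (k + 1 : ℕ) := by push_cast; linarith
          rw [Set.uIoc_of_le hk1] at hy
          rw [norm_sub_rev]
          exact hlip k hk y ⟨hy.1.le, by have := hy.2; push_cast at this; linarith⟩
    _ = n * K := by simp

/-- The same for sums over `Finset.Icc a b` of naturals (`a ≤ b + 1`):
`‖∑_{a ≤ m ≤ b} f(m) - ∫_a^{b+1} f‖ ≤ (b + 1 - a) K`. [folklore] -/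
theorem norm_sum_Icc_sub_integral_le {f : ℝ → ℂ} {a b : ℕ} (hab : a ≤ b + 1) {K : ℝ}
    (hcont : ContinuousOn f (Set.Icc (a : ℝ) (b + 1)))
    (hlip : ∀ m : ℕ, a ≤ m → m ≤ b → ∀ y ∈ Set.Icc (m : ℝ) (m + 1), ‖f y - f m‖ ≤ K) :
    ‖∑ m ∈ Finset.Icc a b, f m - ∫ y in (a : ℝ)..(b + 1 : ℝ), f y‖ ≤ ((b + 1 - a : ℕ) : ℝ) * K := by
  have hsum : ∑ m ∈ Finset.Icc a b, f m = ∑ k ∈ Finset.range (b + 1 - a), f ((a : ℝ) + k) := by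
    rw [← Finset.Ico_add_one_right_eq_Icc, Finset.sum_Ico_eq_sum_range]
    refine Finset.sum_congr rfl fun k _ => ?_
    push_cast; ring_nf
  have hn : (a : ℝ) + ((b + 1 - a : ℕ) : ℝ) = b + 1 := by
    rw [Nat.cast_sub hab]; push_cast; ring
  rw [hsum]
  have := norm_sum_range_sub_integral_le (f := f) (c := a) (n := b + 1 - a) (K := K)
    (by rw [hn]; exact hcont) ?_
  · rwa [hn] at this
  · intro k hk y hy
    have hm : a ≤ a + k := Nat.le_add_right a k
    have hm' : a + k ≤ b := by omega
    have := hlip (a + k) hm hm' y (by push_cast; simpa [add_assoc] using hy)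
    push_cast at this
    simpa [add_assoc] using this

/-- `y ↦ y^w` is continuous on `[a, c]` for `a > 0`. [folklore] -/
theorem continuousOn_ofReal_cpow {w : ℂ} (hw : w ≠ 0) {a c : ℝ} (ha : 0 < a) :
    ContinuousOn (fun y : ℝ => (y : ℂ) ^ w) (Set.Icc a c) := fun _ hy =>
  (hasDerivAt_ofReal_cpow_const (ha.trans_le hy.1).ne' hw).continuousAt.continuousWithinAt

/-- `∫_a^c y^w dy = (c^{w+1} - a^{w+1})/(w+1)` for `0 < a ≤ c`, `w ≠ -1`, with the bound
`‖∫_a^c y^w dy‖ ≤ (c^{Re w + 1} + a^{Re w + 1}) / ‖w + 1‖`. [folklore] -/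
theorem norm_integral_cpow_le {w : ℂ} (hw : w ≠ -1) {a c : ℝ} (ha : 0 < a) (hac : a ≤ c) :
    ‖∫ y in a..c, (y : ℂ) ^ w‖ ≤ (c ^ (w.re + 1) + a ^ (w.re + 1)) / ‖w + 1‖ := by
  have h0 : (0 : ℝ) ∉ Set.uIcc a c := by
    rw [Set.uIcc_of_le hac]; intro h; exact absurd h.1 (not_le.2 ha)
  rw [integral_cpow (Or.inr ⟨hw, h0⟩), norm_div]
  refine div_le_div_of_nonneg_right ?_ (norm_nonneg _)
  refine (norm_sub_le _ _).trans ?_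
  rw [Complex.norm_cpow_eq_rpow_re_of_pos (ha.trans_le hac), Complex.norm_cpow_eq_rpow_re_of_pos ha,
    Complex.add_re, Complex.one_re]

/-! ### The counterexample sequence `a_m = m^{-iν}` and its Dirichlet polynomial -/

/-- The twist `m ↦ m^{-iν}`. [folklore] -/
noncomputable def twist (ν : ℝ) (m : ℕ) : ℂ := (m : ℂ) ^ (-((ν : ℂ) * I))

/-- `|m^{-iν}| = 1` for `m ≥ 1`. [folklore] -/
theorem norm_twist {ν : ℝ} {m : ℕ} (hm : 0 < m) : ‖twist ν m‖ = 1 := by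
  rw [twist, Complex.norm_natCast_cpow_of_pos hm]; simp

/-- `|m^{-iν}| ≤ 1` for all `m` (the value at `m = 0` is `0` or `1`). [folklore] -/
theorem norm_twist_le_one (ν : ℝ) (m : ℕ) : ‖twist ν m‖ ≤ 1 := by
  rcases Nat.eq_zero_or_pos m with rfl | hm
  · rw [twist, Nat.cast_zero]
    rcases eq_or_ne (-((ν : ℂ) * I)) 0 with h0 | h0
    · rw [h0, Complex.cpow_zero, norm_one]
    · rw [Complex.zero_cpow h0, norm_zero]; exact zero_le_one
  · exact (norm_twist hm).le

/-- `m^{-iν} · m^{-1-it} = m^{-1-i(t+ν)}` (`m ≥ 1`). [folklore] -/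
theorem twist_mul_cpow {ν : ℝ} {m : ℕ} (hm : m ≠ 0) (t : ℝ) :
    twist ν m * (m : ℂ) ^ (-(1 + (t : ℂ) * I)) = (m : ℂ) ^ (-(1 + ((t + ν : ℝ) : ℂ) * I)) := by
  rw [twist, ← Complex.cpow_add _ _ (Nat.cast_ne_zero.2 hm)]
  congr 1; push_cast; ring

/-- The partial sum of `ζ` on the `1`-line over `[X, 4X]`: `D(u) = ∑_{X ≤ m ≤ 4X} m^{-1-iu}`. [folklore] -/
noncomputable def Dsum (X u : ℝ) : ℂ := ∑ m ∈ Finset.Icc ⌈X⌉₊ ⌊4 * X⌋₊, (m : ℂ) ^ (-(1 + (u : ℂ) * I))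

/-- For `a_m = m^{-iν}` the Dirichlet polynomial of Lemma 14 is a shift of `D`:
`A(1+it) = D(t + ν)`. [folklore] -/
theorem sum_twist_mul_cpow {X : ℝ} (hX : 0 < X) (ν t : ℝ) :
    ∑ m ∈ Finset.Icc ⌈X⌉₊ ⌊4 * X⌋₊, twist ν m * (m : ℂ) ^ (-(1 + (t : ℂ) * I)) = Dsum X (t + ν) := by
  refine Finset.sum_congr rfl fun m hm => twist_mul_cpow ?_ t
  rw [Finset.mem_Icc] at hm
  have : 1 ≤ ⌈X⌉₊ := Nat.one_le_iff_ne_zero.2 (by rw [Ne, Nat.ceil_eq_zero, not_le]; exact hX)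
  omega

/-- **Pointwise bound for the partial zeta sum**: `|D(u)| ≤ 2/u + 4(1+u)/X` for `u > 0`, `X ≥ 1`
(compare the sum with `∫ y^{-1-iu} dy = O(1/u)`; the `O((1+u)/X)` is `∑ sup|f'|`). [folklore] -/
theorem norm_Dsum_le {X : ℝ} (hX : 1 ≤ X) {u : ℝ} (hu : 0 < u) :
    ‖Dsum X u‖ ≤ 2 / u + 4 * (1 + u) / X := by
  set a := ⌈X⌉₊ with ha
  set b := ⌊4 * X⌋₊ with hb
  set w : ℂ := -(1 + (u : ℂ) * I) with hw
  have hX0 : 0 < X := by linarith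
  have haX : X ≤ a := Nat.le_ceil X
  have ha1 : (a : ℝ) < X + 1 := Nat.ceil_lt_add_one hX0.le
  have hb4 : (b : ℝ) ≤ 4 * X := Nat.floor_le (by linarith)
  have hb4' : 4 * X < (b : ℝ) + 1 := Nat.lt_floor_add_one _
  have hab : a ≤ b + 1 := by
    have : (a : ℝ) ≤ (b : ℝ) + 1 := by linarith
    exact_mod_cast this
  have ha0 : (0 : ℝ) < a := hX0.trans_le haX
  have hwre : w.re = -1 := by simp [hw]
  have hw0 : w ≠ 0 := by
    intro h; have := congrArg Complex.re h; rw [hwre] at this; simp at this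
  have hw1 : w ≠ -1 := by
    intro h; have := congrArg Complex.im h; simp [hw] at this; exact hu.ne' this
  have hwnorm : ‖w‖ ≤ 1 + u := by
    rw [hw, norm_neg]
    refine (norm_add_le _ _).trans ?_
    rw [norm_one, norm_mul, Complex.norm_real, Complex.norm_I, mul_one, Real.norm_eq_abs,
      abs_of_pos hu]
  have hw1norm : ‖w + 1‖ = u := by
    rw [hw, show -(1 + (u : ℂ) * I) + 1 = -((u : ℂ) * I) by ring, norm_neg, norm_mul,
      Complex.norm_real, Complex.norm_I, mul_one, Real.norm_eq_abs, abs_of_pos hu]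
  -- the sum as `∑ f(m)` with `f y = y^w`
  set f : ℝ → ℂ := fun y => (y : ℂ) ^ w with hf
  have hD : Dsum X u = ∑ m ∈ Finset.Icc a b, f m := by
    simp only [Dsum, hf, Complex.ofReal_natCast, ha, hb, hw]
  -- sum versus integral
  have hcmp := norm_sum_Icc_sub_integral_le (f := f) hab (K := (1 + u) / X ^ 2)
    (continuousOn_ofReal_cpow hw0 ha0) (by
      intro m ham _ y hy
      have hmX : X ≤ m := haX.trans (by exact_mod_cast ham)
      have h1 := norm_ofReal_cpow_sub_le hw0 (by rw [hwre]; norm_num) hX0 hmX (hmX.trans hy.1)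
      simp only [hf]
      refine h1.trans ?_
      rw [hwre, show (-1 : ℝ) - 1 = -2 by norm_num, Real.rpow_neg hX0.le,
        show (2 : ℝ) = (2 : ℕ) by norm_num, Real.rpow_natCast, abs_of_nonneg (by linarith [hy.1])]
      have hy1 : y - m ≤ 1 := by linarith [hy.2]
      have hy0 : 0 ≤ y - m := by linarith [hy.1]
      calc ‖w‖ * (X ^ 2)⁻¹ * (y - m) ≤ (1 + u) * (X ^ 2)⁻¹ * 1 :=
            mul_le_mul (mul_le_mul_of_nonneg_right hwnorm (by positivity)) hy1 hy0 (by positivity)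
        _ = (1 + u) / X ^ 2 := by ring)
  -- the integral
  have hint := norm_integral_cpow_le hw1 ha0 (by exact_mod_cast hab : (a : ℝ) ≤ (b + 1 : ℕ))
  rw [hwre, hw1norm] at hint
  norm_num at hint
  -- `(b + 1 - a) (1+u)/X² ≤ 4(1+u)/X`
  have hcard : ((b + 1 - a : ℕ) : ℝ) ≤ 4 * X := by
    rw [Nat.cast_sub hab]; push_cast; linarith
  have herr : ((b + 1 - a : ℕ) : ℝ) * ((1 + u) / X ^ 2) ≤ 4 * (1 + u) / X := by
    calc ((b + 1 - a : ℕ) : ℝ) * ((1 + u) / X ^ 2) ≤ 4 * X * ((1 + u) / X ^ 2) :=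
          mul_le_mul_of_nonneg_right hcard (by positivity)
      _ = 4 * (1 + u) / X := by field_simp
  have hb1 : ((b : ℝ) + 1) = ((b + 1 : ℕ) : ℝ) := by push_cast; ring
  calc ‖Dsum X u‖ = ‖(∫ y in (a : ℝ)..(b + 1 : ℝ), f y)
        + (∑ m ∈ Finset.Icc a b, f m - ∫ y in (a : ℝ)..(b + 1 : ℝ), f y)‖ := by
        rw [hD]; congr 1; ring
    _ ≤ ‖∫ y in (a : ℝ)..(b + 1 : ℝ), f y‖ + ‖∑ m ∈ Finset.Icc a b, f m - ∫ y in (a : ℝ)..(b + 1 : ℝ), f y‖ :=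
        norm_add_le _ _
    _ ≤ 2 / u + 4 * (1 + u) / X := by
        refine add_le_add ?_ (hcmp.trans herr)
        rw [hb1]; simpa [hf] using hint

/-! ### The short sums `S(x, h) = ∑_{x ≤ m ≤ x+h} m^{-iν}` -/

/-- `S(x, h) = ∑_{x ≤ m ≤ x + h} m^{-iν}` (integers of `[x, x+h]`, as in Lemma 14). [folklore] -/
noncomputable def Ssum (ν x h : ℝ) : ℂ := ∑ m ∈ Finset.Icc ⌈x⌉₊ ⌊x + h⌋₊, twist ν m

/-- The number of integers in `[x, x+h]` is at least `h - 1` (`x ≥ 0`, `h ≥ 1`). [folklore] -/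
theorem sub_one_le_card_Icc {x h : ℝ} (hx : 0 ≤ x) (hh : 1 ≤ h) :
    h - 1 ≤ (#(Finset.Icc ⌈x⌉₊ ⌊x + h⌋₊) : ℝ) := by
  have ha1 : (⌈x⌉₊ : ℝ) < x + 1 := Nat.ceil_lt_add_one hx
  have hb2 : x + h < (⌊x + h⌋₊ : ℝ) + 1 := Nat.lt_floor_add_one _
  have hab : ⌈x⌉₊ ≤ ⌊x + h⌋₊ + 1 := by
    have : (⌈x⌉₊ : ℝ) < ⌊x + h⌋₊ + 1 := by linarith
    exact_mod_cast this.le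
  rw [Nat.card_Icc, Nat.cast_sub hab]
  push_cast
  linarith

/-- `|S(x, h)| ≤ h + 1` (there are at most `h + 1` integers in `[x, x+h]`; cf.
`Literature.NumberTheory.LFunctions.Tao2016.card_Icc_ceil_floor_le`, not imported here to keep the
import chain light). [folklore] -/
theorem norm_Ssum_le_add_one (ν : ℝ) {x h : ℝ} (hx : 0 ≤ x) (hh : 0 ≤ h) :
    ‖Ssum ν x h‖ ≤ h + 1 := by
  have hcard : (#(Finset.Icc ⌈x⌉₊ ⌊x + h⌋₊) : ℝ) ≤ h + 1 := by
    have ha : x ≤ (⌈x⌉₊ : ℝ) := Nat.le_ceil x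
    have hb : (⌊x + h⌋₊ : ℝ) ≤ x + h := Nat.floor_le (by linarith)
    rw [Nat.card_Icc]
    rcases le_or_gt ⌈x⌉₊ (⌊x + h⌋₊ + 1) with h1 | h1
    · rw [Nat.cast_sub h1]; push_cast; linarith
    · rw [Nat.sub_eq_zero_of_le h1.le]; push_cast; linarith
  unfold Ssum
  calc ‖∑ m ∈ Finset.Icc ⌈x⌉₊ ⌊x + h⌋₊, twist ν m‖ ≤ ∑ m ∈ Finset.Icc ⌈x⌉₊ ⌊x + h⌋₊, ‖twist ν m‖ :=
        norm_sum_le _ _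
    _ ≤ ∑ _m ∈ Finset.Icc ⌈x⌉₊ ⌊x + h⌋₊, (1 : ℝ) := Finset.sum_le_sum fun m _ => norm_twist_le_one ν m
    _ = #(Finset.Icc ⌈x⌉₊ ⌊x + h⌋₊) := by simp
    _ ≤ h + 1 := hcard

/-- **Upper bound for the long sum** (cancellation in `∑ m^{-iν}` over `[x, x+h]`):
`|S(x, h)| ≤ 7X/ν + (h+1)ν/X` for `1 ≤ X ≤ x ≤ 2X`, `0 ≤ h ≤ X`, `ν > 0`
(sum versus `∫ y^{-iν} dy = y^{1-iν}/(1-iν)`). [folklore] -/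
theorem norm_Ssum_le {ν X x h : ℝ} (hν : 0 < ν) (hX : 1 ≤ X) (hx : X ≤ x) (hx2 : x ≤ 2 * X)
    (hh : 0 ≤ h) (hhX : h ≤ X) :
    ‖Ssum ν x h‖ ≤ 7 * X / ν + (h + 1) * ν / X := by
  set a := ⌈x⌉₊ with ha
  set b := ⌊x + h⌋₊ with hb
  set w : ℂ := -((ν : ℂ) * I) with hw
  have hX0 : 0 < X := by linarith
  have hx0 : 0 ≤ x := by linarith
  have hax : x ≤ a := Nat.le_ceil x
  have ha1 : (a : ℝ) < x + 1 := Nat.ceil_lt_add_one hx0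
  have hb1 : (b : ℝ) ≤ x + h := Nat.floor_le (by linarith)
  have hb2 : x + h < (b : ℝ) + 1 := Nat.lt_floor_add_one _
  have hab : a ≤ b + 1 := by
    have : (a : ℝ) < (b : ℝ) + 2 := by linarith
    have : a < b + 2 := by exact_mod_cast this
    omega
  have ha0 : (0 : ℝ) < a := by linarith
  have hXa : X ≤ a := hx.trans hax
  have hwre : w.re = 0 := by simp [hw]
  have hw0 : w ≠ 0 := by
    intro h0; have := congrArg Complex.im h0; simp [hw] at this; exact hν.ne' this
  have hw1 : w ≠ -1 := by
    intro h0; have := congrArg Complex.re h0; rw [hwre] at this; simp at this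
  have hwnorm : ‖w‖ = ν := by
    rw [hw, norm_neg, norm_mul, Complex.norm_real, Complex.norm_I, mul_one, Real.norm_eq_abs,
      abs_of_pos hν]
  have hw1norm : ν ≤ ‖w + 1‖ := by
    have := Complex.abs_im_le_norm (w + 1)
    simp [hw] at this
    rwa [abs_of_pos hν] at this
  set f : ℝ → ℂ := fun y => (y : ℂ) ^ w with hf
  have hS : Ssum ν x h = ∑ m ∈ Finset.Icc a b, f m := by
    simp only [Ssum, twist, hf, Complex.ofReal_natCast, ha, hb, hw]
  have hcmp := norm_sum_Icc_sub_integral_le (f := f) hab (K := ν / X)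
    (continuousOn_ofReal_cpow hw0 ha0) (by
      intro m ham _ y hy
      have hmX : X ≤ m := hXa.trans (by exact_mod_cast ham)
      have h1 := norm_ofReal_cpow_sub_le hw0 (by rw [hwre]; norm_num) hX0 hmX (hmX.trans hy.1)
      simp only [hf]
      refine h1.trans ?_
      rw [hwre, hwnorm, show (0 : ℝ) - 1 = -1 by norm_num, Real.rpow_neg_one,
        abs_of_nonneg (by linarith [hy.1])]
      have hy1 : y - m ≤ 1 := by linarith [hy.2]
      have hy0 : 0 ≤ y - m := by linarith [hy.1]
      calc ν * X⁻¹ * (y - m) ≤ ν * X⁻¹ * 1 := mul_le_mul_of_nonneg_left hy1 (by positivity)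
        _ = ν / X := by ring)
  have hint := norm_integral_cpow_le hw1 ha0 (by exact_mod_cast hab : (a : ℝ) ≤ (b + 1 : ℕ))
  rw [hwre, zero_add, Real.rpow_one, Real.rpow_one] at hint
  have hint' : ‖∫ y in (a : ℝ)..((b + 1 : ℕ) : ℝ), (y : ℂ) ^ w‖ ≤ 7 * X / ν := by
    refine hint.trans ?_
    have hnum : ((b + 1 : ℕ) : ℝ) + a ≤ 7 * X := by push_cast; linarith
    calc (((b + 1 : ℕ) : ℝ) + a) / ‖w + 1‖ ≤ (((b + 1 : ℕ) : ℝ) + a) / ν :=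
          div_le_div_of_nonneg_left (by positivity) hν hw1norm
      _ ≤ 7 * X / ν := div_le_div_of_nonneg_right hnum hν.le
  have hcard : ((b + 1 - a : ℕ) : ℝ) ≤ h + 1 := by
    rw [Nat.cast_sub hab]; push_cast; linarith
  have herr : ((b + 1 - a : ℕ) : ℝ) * (ν / X) ≤ (h + 1) * ν / X := by
    rw [← mul_div_assoc]
    exact div_le_div_of_nonneg_right (mul_le_mul_of_nonneg_right hcard hν.le) hX0.le
  have hb1' : ((b : ℝ) + 1) = ((b + 1 : ℕ) : ℝ) := by push_cast; ring
  calc ‖Ssum ν x h‖ = ‖(∫ y in (a : ℝ)..(b + 1 : ℝ), f y)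
        + (∑ m ∈ Finset.Icc a b, f m - ∫ y in (a : ℝ)..(b + 1 : ℝ), f y)‖ := by
        rw [hS]; congr 1; ring
    _ ≤ ‖∫ y in (a : ℝ)..(b + 1 : ℝ), f y‖ + ‖∑ m ∈ Finset.Icc a b, f m - ∫ y in (a : ℝ)..(b + 1 : ℝ), f y‖ :=
        norm_add_le _ _
    _ ≤ 7 * X / ν + (h + 1) * ν / X := by
        refine add_le_add ?_ (hcmp.trans herr)
        rw [hb1']; simpa [hf] using hint'

/-- **Lower bound for the short sum** (the phase `m^{-iν}` is nearly constant on `[x, x+h]` when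
`νh/X` is small): `#{x ≤ m ≤ x+h} · (1 - νh/X) ≤ |S(x, h)|` for `0 < X ≤ x`, `h ≥ 0`. [folklore] -/
theorem card_mul_le_norm_Ssum {ν X x h : ℝ} (hν : 0 < ν) (hX : 0 < X) (hx : X ≤ x) (hh : 0 ≤ h) :
    (#(Finset.Icc ⌈x⌉₊ ⌊x + h⌋₊) : ℝ) * (1 - ν * h / X) ≤ ‖Ssum ν x h‖ := by
  set a := ⌈x⌉₊ with ha
  set b := ⌊x + h⌋₊ with hb
  set s := Finset.Icc a b with hs
  set w : ℂ := -((ν : ℂ) * I) with hw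
  have hx0 : 0 ≤ x := by linarith
  have hax : x ≤ a := Nat.le_ceil x
  have hb1 : (b : ℝ) ≤ x + h := Nat.floor_le (by linarith)
  have ha0 : (0 : ℝ) < a := by linarith
  have ha0' : 0 < a := by exact_mod_cast ha0
  have hXa : X ≤ a := hx.trans hax
  have hwre : w.re = 0 := by simp [hw]
  have hw0 : w ≠ 0 := by
    intro h0; have := congrArg Complex.im h0; simp [hw] at this; exact hν.ne' this
  have hwnorm : ‖w‖ = ν := by
    rw [hw, norm_neg, norm_mul, Complex.norm_real, Complex.norm_I, mul_one, Real.norm_eq_abs,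
      abs_of_pos hν]
  -- each term is close to the first one
  have hterm : ∀ m ∈ s, ‖twist ν m - twist ν a‖ ≤ ν * h / X := by
    intro m hm
    rw [hs, Finset.mem_Icc] at hm
    have ham : (a : ℝ) ≤ m := by exact_mod_cast hm.1
    have hmb : (m : ℝ) ≤ b := by exact_mod_cast hm.2
    have h1 := norm_ofReal_cpow_sub_le hw0 (by rw [hwre]; norm_num) hX hXa (hXa.trans ham)
    rw [hwre, hwnorm, show (0 : ℝ) - 1 = -1 by norm_num, Real.rpow_neg_one,
      abs_of_nonneg (by linarith)] at h1
    have e1 : twist ν m - twist ν a = ((m : ℝ) : ℂ) ^ w - ((a : ℝ) : ℂ) ^ w := by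
      simp [twist, hw]
    rw [e1]
    refine h1.trans ?_
    rw [mul_div_assoc, mul_comm ν X⁻¹, mul_assoc, ← div_eq_inv_mul, mul_div_assoc]
    refine mul_le_mul_of_nonneg_left (div_le_div_of_nonneg_right (by linarith) hX.le) hν.le
  have hdiff : ‖Ssum ν x h - (#s : ℂ) * twist ν a‖ ≤ #s * (ν * h / X) := by
    have e : Ssum ν x h - (#s : ℂ) * twist ν a = ∑ m ∈ s, (twist ν m - twist ν a) := by
      rw [Finset.sum_sub_distrib, Finset.sum_const, nsmul_eq_mul, Ssum]
    rw [e]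
    calc ‖∑ m ∈ s, (twist ν m - twist ν a)‖ ≤ ∑ m ∈ s, ‖twist ν m - twist ν a‖ := norm_sum_le _ _
      _ ≤ ∑ _m ∈ s, ν * h / X := Finset.sum_le_sum hterm
      _ = #s * (ν * h / X) := by rw [Finset.sum_const, nsmul_eq_mul]
  have hmain : ‖(#s : ℂ) * twist ν a‖ = #s := by
    rw [norm_mul, norm_twist ha0', mul_one, Complex.norm_natCast]
  have := norm_sub_norm_le ((#s : ℂ) * twist ν a) (Ssum ν x h)
  rw [hmain, norm_sub_rev] at this
  have h3 : (#s : ℝ) - ‖Ssum ν x h‖ ≤ #s * (ν * h / X) := this.trans hdiff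
  rw [mul_sub, mul_one]
  linarith

/-! ### The left-hand side of Lemma 14 for `a_m = m^{-iν}` -/

/-- The integrand of the left-hand side of Lemma 14 for `a_m = m^{-iν}`:
`|S(x,h₁)/h₁ - S(x,h₂)/h₂|²`. [folklore] -/
noncomputable def lhsFun (ν h₁ h₂ : ℝ) (x : ℝ) : ℝ :=
  ‖(h₁ : ℂ)⁻¹ * Ssum ν x h₁ - ((h₂ : ℝ) : ℂ)⁻¹ * Ssum ν x h₂‖ ^ 2

/-- `x ↦ S(x, h)` is measurable (it factors through `x ↦ (⌈x⌉₊, ⌊x+h⌋₊) ∈ ℕ × ℕ`). [folklore] -/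
theorem measurable_Ssum (ν h : ℝ) : Measurable fun x : ℝ => Ssum ν x h := by
  set G : ℕ × ℕ → ℂ := fun p => ∑ m ∈ Finset.Icc p.1 p.2, twist ν m with hG
  have hGm : Measurable G := measurable_of_countable G
  have hp : Measurable fun x : ℝ => (⌈x⌉₊, ⌊x + h⌋₊) :=
    Nat.measurable_ceil.prodMk (Nat.measurable_floor.comp (measurable_id.add_const h))
  exact hGm.comp hp

/-- The integrand is measurable. [folklore] -/
theorem measurable_lhsFun (ν h₁ h₂ : ℝ) : Measurable (lhsFun ν h₁ h₂) := by
  unfold lhsFun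
  exact (((measurable_const.mul (measurable_Ssum ν h₁)).sub
    (measurable_const.mul (measurable_Ssum ν h₂))).norm).pow_const 2

/-- The integrand is bounded by `16` on `x ≥ 0` when `h₁, h₂ ≥ 1`. [folklore] -/
theorem lhsFun_le {ν h₁ h₂ x : ℝ} (hh₁ : 1 ≤ h₁) (hh₂ : 1 ≤ h₂) (hx : 0 ≤ x) :
    lhsFun ν h₁ h₂ x ≤ 16 := by
  have h1 : ‖(h₁ : ℂ)⁻¹ * Ssum ν x h₁‖ ≤ 2 := by
    rw [norm_mul, norm_inv, Complex.norm_real, Real.norm_eq_abs, abs_of_pos (by linarith),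
      inv_mul_le_iff₀ (by linarith)]
    have := norm_Ssum_le_add_one ν hx (by linarith : (0 : ℝ) ≤ h₁)
    linarith
  have h2 : ‖((h₂ : ℝ) : ℂ)⁻¹ * Ssum ν x h₂‖ ≤ 2 := by
    rw [norm_mul, norm_inv, Complex.norm_real, Real.norm_eq_abs, abs_of_pos (by linarith),
      inv_mul_le_iff₀ (by linarith)]
    have := norm_Ssum_le_add_one ν hx (by linarith : (0 : ℝ) ≤ h₂)
    linarith
  have h3 : ‖(h₁ : ℂ)⁻¹ * Ssum ν x h₁ - ((h₂ : ℝ) : ℂ)⁻¹ * Ssum ν x h₂‖ ≤ 4 :=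
    (norm_sub_le _ _).trans (by linarith)
  unfold lhsFun
  nlinarith [norm_nonneg ((h₁ : ℂ)⁻¹ * Ssum ν x h₁ - ((h₂ : ℝ) : ℂ)⁻¹ * Ssum ν x h₂)]

/-- The integrand is integrable on `[X, 2X]` (`X ≥ 0`, `h₁, h₂ ≥ 1`). [folklore] -/
theorem intervalIntegrable_lhsFun {ν h₁ h₂ X : ℝ} (hh₁ : 1 ≤ h₁) (hh₂ : 1 ≤ h₂) (hX : 0 ≤ X) :
    IntervalIntegrable (lhsFun ν h₁ h₂) volume X (2 * X) := by
  rw [intervalIntegrable_iff_integrableOn_Icc_of_le (by linarith)]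
  refine Measure.integrableOn_of_bounded (M := 16) (by simp [Real.volume_Icc])
    (measurable_lhsFun ν h₁ h₂).aestronglyMeasurable ?_
  refine (ae_restrict_iff' measurableSet_Icc).2 (Filter.Eventually.of_forall fun x hx => ?_)
  rw [Real.norm_eq_abs, abs_of_nonneg (by unfold lhsFun; positivity)]
  exact lhsFun_le hh₁ hh₂ (hX.trans hx.1)

/-- **The left-hand side is large**: if `(1 - 1/h₁)(1 - νh₁/X) ≥ 1 - δ₁`,
`(7X/ν + (h₂+1)ν/X)/h₂ ≤ δ₂` and `δ₁ + δ₂ ≤ 1/2`, then `|S(x,h₁)/h₁ - S(x,h₂)/h₂|² ≥ 1/4` for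
`x ∈ [X, 2X]`. [folklore] -/
theorem lhsFun_ge {ν X x h₁ h₂ δ₁ δ₂ : ℝ} (hν : 0 < ν) (hX : 1 ≤ X) (hx : X ≤ x) (hx2 : x ≤ 2 * X)
    (hh₁ : 1 ≤ h₁) (hh₂ : 0 < h₂) (hh₂X : h₂ ≤ X) (hsmall : ν * h₁ / X ≤ 1)
    (h1 : 1 - δ₁ ≤ (1 - 1 / h₁) * (1 - ν * h₁ / X))
    (h2 : (7 * X / ν + (h₂ + 1) * ν / X) / h₂ ≤ δ₂) (hδ : δ₁ + δ₂ ≤ 1 / 2) :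
    1 / 4 ≤ lhsFun ν h₁ h₂ x := by
  have hX0 : 0 < X := by linarith
  have hx0 : 0 ≤ x := by linarith
  have hh₁0 : 0 < h₁ := by linarith
  -- the short sum is large
  have hcard := sub_one_le_card_Icc hx0 hh₁
  have hlow := card_mul_le_norm_Ssum hν hX0 hx (by linarith : (0 : ℝ) ≤ h₁)
  have hA : 1 - δ₁ ≤ ‖(h₁ : ℂ)⁻¹ * Ssum ν x h₁‖ := by
    rw [norm_mul, norm_inv, Complex.norm_real, Real.norm_eq_abs, abs_of_pos hh₁0]
    have h3 : (h₁ - 1) * (1 - ν * h₁ / X) ≤ ‖Ssum ν x h₁‖ :=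
      (mul_le_mul_of_nonneg_right hcard (by linarith)).trans hlow
    have h4 : (1 - 1 / h₁) * (1 - ν * h₁ / X) = h₁⁻¹ * ((h₁ - 1) * (1 - ν * h₁ / X)) := by
      field_simp
    rw [h4] at h1
    exact h1.trans (mul_le_mul_of_nonneg_left h3 (inv_pos.2 hh₁0).le)
  -- the long sum is small
  have hB : ‖((h₂ : ℝ) : ℂ)⁻¹ * Ssum ν x h₂‖ ≤ δ₂ := by
    rw [norm_mul, norm_inv, Complex.norm_real, Real.norm_eq_abs, abs_of_pos hh₂, ← div_eq_inv_mul]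
    exact (div_le_div_of_nonneg_right (norm_Ssum_le hν hX hx hx2 hh₂.le hh₂X) hh₂.le).trans h2
  have hC : 1 / 2 ≤ ‖(h₁ : ℂ)⁻¹ * Ssum ν x h₁ - ((h₂ : ℝ) : ℂ)⁻¹ * Ssum ν x h₂‖ := by
    have := norm_sub_norm_le ((h₁ : ℂ)⁻¹ * Ssum ν x h₁) (((h₂ : ℝ) : ℂ)⁻¹ * Ssum ν x h₂)
    linarith
  unfold lhsFun
  nlinarith

/-- **Mean lower bound**: under the hypotheses of `lhsFun_ge` (for all `x ∈ [X, 2X]`),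
`(1/X) ∫_X^{2X} |S(x,h₁)/h₁ - S(x,h₂)/h₂|² dx ≥ 1/4`. [folklore] -/
theorem inv_mul_integral_lhsFun_ge {ν X h₁ h₂ δ₁ δ₂ : ℝ} (hν : 0 < ν) (hX : 1 ≤ X)
    (hh₁ : 1 ≤ h₁) (hh₂ : 1 ≤ h₂) (hh₂X : h₂ ≤ X) (hsmall : ν * h₁ / X ≤ 1)
    (h1 : 1 - δ₁ ≤ (1 - 1 / h₁) * (1 - ν * h₁ / X))
    (h2 : (7 * X / ν + (h₂ + 1) * ν / X) / h₂ ≤ δ₂) (hδ : δ₁ + δ₂ ≤ 1 / 2) :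
    1 / 4 ≤ X⁻¹ * ∫ x in X..2 * X, lhsFun ν h₁ h₂ x := by
  have hX0 : 0 < X := by linarith
  have hmono := intervalIntegral.integral_mono_on (by linarith : X ≤ 2 * X)
    (intervalIntegrable_const (c := (1 / 4 : ℝ)) (μ := volume) (a := X) (b := 2 * X))
    (intervalIntegrable_lhsFun (ν := ν) hh₁ hh₂ hX0.le)
    (fun x hx => lhsFun_ge hν hX hx.1 hx.2 hh₁ (by linarith) hh₂X hsmall h1 h2 hδ)
  rw [intervalIntegral.integral_const, smul_eq_mul] at hmono
  rw [← div_eq_inv_mul, le_div_iff₀ hX0]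
  linarith

/-! ### The right-hand side of Lemma 14 for `a_m = m^{-iν}` -/

/-- `D` is continuous. [folklore] -/
theorem continuous_Dsum (X : ℝ) : Continuous (Dsum X) := by
  unfold Dsum
  refine continuous_finsetSum _ fun m _ => ?_
  refine Continuous.const_cpow (by fun_prop) (Or.inr fun u h0 => ?_)
  have := congrArg Complex.re h0
  simp at this

/-- **The integral term is small**: `∫_{T₀}^{U} |D(t+ν)|² dt ≤ (U - T₀)(2/ν + 4(1+U+ν)/X)²`
for `0 ≤ T₀ ≤ U`, `ν > 0`. [folklore] -/
theorem integral_term_le {X ν T₀ U : ℝ} (hX : 1 ≤ X) (hν : 0 < ν) (hT₀ : 0 ≤ T₀) (hTU : T₀ ≤ U) :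
    ∫ t in T₀..U, ‖Dsum X (t + ν)‖ ^ 2 ≤ (U - T₀) * (2 / ν + 4 * (1 + U + ν) / X) ^ 2 := by
  have hX0 : 0 < X := by linarith
  set B := 2 / ν + 4 * (1 + U + ν) / X with hB
  have hbound : ∀ t ∈ Set.uIoc T₀ U, ‖‖Dsum X (t + ν)‖ ^ 2‖ ≤ B ^ 2 := by
    intro t ht
    rw [Set.uIoc_of_le hTU] at ht
    have ht0 : 0 < t + ν := by linarith [ht.1]
    rw [Real.norm_eq_abs, abs_of_nonneg (sq_nonneg _)]
    have hD' : ‖Dsum X (t + ν)‖ ≤ B := by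
      refine (norm_Dsum_le hX ht0).trans (add_le_add ?_ ?_)
      · exact div_le_div_of_nonneg_left (by norm_num) hν (by linarith [ht.1])
      · refine div_le_div_of_nonneg_right ?_ hX0.le
        linarith [ht.2]
    exact pow_le_pow_left₀ (norm_nonneg _) hD' 2
  have h := intervalIntegral.norm_integral_le_of_norm_le_const hbound
  rw [abs_of_nonneg (by linarith), Real.norm_eq_abs] at h
  have := le_abs_self (∫ t in T₀..U, ‖Dsum X (t + ν)‖ ^ 2)
  linarith

/-- The `max` term, small `T`: `(U/T)∫_T^{2T}|D(t+ν)|² ≤ 8/U + 32U(1+2T+ν)²/X²` for `0 < U ≤ T`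
(pointwise bound). [folklore] -/
theorem max_term_le_small {X ν U T : ℝ} (hX : 1 ≤ X) (hν : 0 ≤ ν) (hU : 0 < U) (hUT : U ≤ T) :
    U / T * ∫ t in T..2 * T, ‖Dsum X (t + ν)‖ ^ 2
      ≤ 8 / U + 32 * U * (1 + 2 * T + ν) ^ 2 / X ^ 2 := by
  have hX0 : 0 < X := by linarith
  have hT : 0 < T := hU.trans_le hUT
  set B := 2 / T + 4 * (1 + 2 * T + ν) / X with hB
  have hbound : ∀ t ∈ Set.uIoc T (2 * T), ‖‖Dsum X (t + ν)‖ ^ 2‖ ≤ B ^ 2 := by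
    intro t ht
    rw [Set.uIoc_of_le (by linarith)] at ht
    have ht0 : 0 < t + ν := by linarith [ht.1]
    rw [Real.norm_eq_abs, abs_of_nonneg (sq_nonneg _)]
    have hD' : ‖Dsum X (t + ν)‖ ≤ B := by
      refine (norm_Dsum_le hX ht0).trans (add_le_add ?_ ?_)
      · exact div_le_div_of_nonneg_left (by norm_num) hT (by linarith [ht.1])
      · refine div_le_div_of_nonneg_right ?_ hX0.le
        linarith [ht.2]
    exact pow_le_pow_left₀ (norm_nonneg _) hD' 2
  have h := intervalIntegral.norm_integral_le_of_norm_le_const hbound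
  rw [show 2 * T - T = T by ring, abs_of_pos hT, Real.norm_eq_abs] at h
  have h' : ∫ t in T..2 * T, ‖Dsum X (t + ν)‖ ^ 2 ≤ B ^ 2 * T := (le_abs_self _).trans h
  have hsq : B ^ 2 ≤ 2 * (2 / T) ^ 2 + 2 * (4 * (1 + 2 * T + ν) / X) ^ 2 := by
    rw [hB]; nlinarith [sq_nonneg (2 / T - 4 * (1 + 2 * T + ν) / X)]
  have hUT2 : U / T ^ 2 ≤ 1 / U := by
    rw [div_le_div_iff₀ (by positivity) hU]
    nlinarith
  calc U / T * ∫ t in T..2 * T, ‖Dsum X (t + ν)‖ ^ 2 ≤ U / T * (B ^ 2 * T) :=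
        mul_le_mul_of_nonneg_left h' (by positivity)
    _ = U * B ^ 2 := by field_simp
    _ ≤ U * (2 * (2 / T) ^ 2 + 2 * (4 * (1 + 2 * T + ν) / X) ^ 2) :=
        mul_le_mul_of_nonneg_left hsq hU.le
    _ = 8 * (U / T ^ 2) + 32 * U * (1 + 2 * T + ν) ^ 2 / X ^ 2 := by field_simp; ring
    _ ≤ 8 * (1 / U) + 32 * U * (1 + 2 * T + ν) ^ 2 / X ^ 2 := by gcongr
    _ = 8 / U + 32 * U * (1 + 2 * T + ν) ^ 2 / X ^ 2 := by ring

/-- **`D` as a Dirichlet polynomial and the weak mean value theorem**: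
`∫_{-V}^{V} |D(u)|² du ≤ (5V + 18⌊4X⌋)(4/X)`, from
`Literature.NumberTheory.LFunctions.dirichletPolynomial_meanSquare_le` with coefficients
`b_n = 1/n` on `[X, 4X]` (`∑ |b_n|² ≤ 4/X`). [cite: Ivic1985, Theorem 5.2 (weak form)] -/
theorem integral_norm_Dsum_sq_le {X : ℝ} (hX : 1 ≤ X) {V : ℝ} (hV : 0 < V) :
    ∫ u in -V..V, ‖Dsum X u‖ ^ 2 ≤ (5 * V + 18 * (⌊4 * X⌋₊ : ℝ)) * (4 / X) := by
  have hX0 : 0 < X := by linarith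
  set N := ⌊4 * X⌋₊ with hN
  set A := ⌈X⌉₊ with hA
  have hA1 : 1 ≤ A := Nat.one_le_iff_ne_zero.2 (by rw [hA, Ne, Nat.ceil_eq_zero, not_le]; exact hX0)
  have hAX : X ≤ A := Nat.le_ceil X
  have hA2 : (A : ℝ) < X + 1 := Nat.ceil_lt_add_one hX0.le
  have hN4 : (N : ℝ) ≤ 4 * X := Nat.floor_le (by linarith)
  set b : ℕ → ℂ := fun n => if A ≤ n then ((n : ℂ))⁻¹ else 0 with hb
  have hfilter : (Finset.Icc 1 N).filter (fun n => A ≤ n) = Finset.Icc A N := by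
    ext n; simp only [Finset.mem_filter, Finset.mem_Icc]; omega
  have hrepr : ∀ u : ℝ, Dsum X u = ∑ n ∈ Finset.Icc 1 N, b n * (n : ℂ) ^ (-((u : ℂ) * I)) := by
    intro u
    simp only [hb, ite_mul, zero_mul]
    rw [← Finset.sum_filter, hfilter, Dsum]
    refine Finset.sum_congr rfl fun n hn => ?_
    rw [Finset.mem_Icc] at hn
    have hn0 : (n : ℂ) ≠ 0 := Nat.cast_ne_zero.2 (by omega)
    rw [show -(1 + (u : ℂ) * I) = (-1) + (-((u : ℂ) * I)) by ring, Complex.cpow_add _ _ hn0,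
      Complex.cpow_neg_one]
  have hb2 : ∑ n ∈ Finset.Icc 1 N, ‖b n‖ ^ 2 ≤ 4 / X := by
    have e : ∀ n, ‖b n‖ ^ 2 = if A ≤ n then ‖((n : ℂ))⁻¹‖ ^ 2 else 0 := by
      intro n; simp only [hb]; split_ifs <;> simp
    simp only [e]
    rw [← Finset.sum_filter, hfilter]
    have hterm : ∀ n ∈ Finset.Icc A N, ‖((n : ℂ))⁻¹‖ ^ 2 ≤ 1 / X ^ 2 := by
      intro n hn
      rw [Finset.mem_Icc] at hn
      have hnX : X ≤ n := hAX.trans (by exact_mod_cast hn.1)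
      have hn0 : (0 : ℝ) < n := hX0.trans_le hnX
      rw [norm_inv, Complex.norm_natCast, inv_pow, one_div]
      exact inv_anti₀ (by positivity) (pow_le_pow_left₀ hX0.le hnX 2)
    refine (Finset.sum_le_sum hterm).trans ?_
    rw [Finset.sum_const, nsmul_eq_mul, Nat.card_Icc]
    have hcard : ((N + 1 - A : ℕ) : ℝ) ≤ 4 * X := by
      rcases le_or_gt A (N + 1) with h | h
      · rw [Nat.cast_sub h]; push_cast; linarith
      · rw [Nat.sub_eq_zero_of_le h.le]; push_cast; linarith
    calc ((N + 1 - A : ℕ) : ℝ) * (1 / X ^ 2) ≤ 4 * X * (1 / X ^ 2) :=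
          mul_le_mul_of_nonneg_right hcard (by positivity)
      _ = 4 / X := by field_simp
  have hmv := Literature.NumberTheory.LFunctions.dirichletPolynomial_meanSquare_le b N hV
  simp only [← hrepr] at hmv
  refine hmv.trans ?_
  exact mul_le_mul_of_nonneg_left hb2 (by positivity)

/-- The `max` term, large `T`: `(U/T)∫_T^{2T}|D(t+ν)|² ≤ 40U/X + 20νU/(TX) + 288U/T` for
`0 < U ≤ T`, by the mean value theorem on `[-(2T+ν), 2T+ν]`. [folklore] -/
theorem max_term_le_large {X ν U T : ℝ} (hX : 1 ≤ X) (hν : 0 ≤ ν) (hU : 0 < U) (hUT : U ≤ T) :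
    U / T * ∫ t in T..2 * T, ‖Dsum X (t + ν)‖ ^ 2
      ≤ 40 * U / X + 20 * ν * U / (T * X) + 288 * U / T := by
  have hX0 : 0 < X := by linarith
  have hT : 0 < T := hU.trans_le hUT
  have hN4 : (⌊4 * X⌋₊ : ℝ) ≤ 4 * X := Nat.floor_le (by linarith)
  have step1 : ∫ t in T..2 * T, ‖Dsum X (t + ν)‖ ^ 2 = ∫ u in T + ν..2 * T + ν, ‖Dsum X u‖ ^ 2 :=
    intervalIntegral.integral_comp_add_right (fun u => ‖Dsum X u‖ ^ 2) ν
  have step2 : ∫ u in T + ν..2 * T + ν, ‖Dsum X u‖ ^ 2 ≤ ∫ u in -(2 * T + ν)..2 * T + ν, ‖Dsum X u‖ ^ 2 :=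
    intervalIntegral.integral_mono_interval (by linarith) (by linarith) le_rfl
      (Filter.Eventually.of_forall fun u => sq_nonneg _)
      (((continuous_Dsum X).norm.pow 2).intervalIntegrable _ _)
  have step3 := integral_norm_Dsum_sq_le hX (by linarith : 0 < 2 * T + ν)
  have h4 : ∫ t in T..2 * T, ‖Dsum X (t + ν)‖ ^ 2 ≤ (10 * T + 5 * ν + 72 * X) * (4 / X) := by
    rw [step1]
    refine (step2.trans step3).trans (mul_le_mul_of_nonneg_right (by linarith) (by positivity))
  calc U / T * ∫ t in T..2 * T, ‖Dsum X (t + ν)‖ ^ 2 ≤ U / T * ((10 * T + 5 * ν + 72 * X) * (4 / X)) :=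
        mul_le_mul_of_nonneg_left h4 (by positivity)
    _ = 40 * U / X + 20 * ν * U / (T * X) + 288 * U / T := by field_simp; ring

/-- **The `max` term is small**: for every `Θ > 0`,
`sup_{T ≥ U} (U/T)∫_T^{2T}|D(t+ν)|² ≤ (8/U + 32U(1+2Θ+ν)²/X²) + (40U/X + 20νU/(ΘX) + 288U/Θ)`
(the first group from `T ≤ Θ`, the second from `T ≥ Θ`). [folklore] -/
theorem iSup_max_term_le {X ν U Θ : ℝ} (hX : 1 ≤ X) (hν : 0 ≤ ν) (hU : 0 < U) (hΘ : 0 < Θ) :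
    (⨆ T : Set.Ici U, U / (T : ℝ) * ∫ t in (T : ℝ)..2 * T, ‖Dsum X (t + ν)‖ ^ 2)
      ≤ (8 / U + 32 * U * (1 + 2 * Θ + ν) ^ 2 / X ^ 2)
        + (40 * U / X + 20 * ν * U / (Θ * X) + 288 * U / Θ) := by
  have hX0 : 0 < X := by linarith
  haveI : Nonempty (Set.Ici U) := ⟨⟨U, Set.self_mem_Ici⟩⟩
  refine ciSup_le fun T => ?_
  have hUT : U ≤ (T : ℝ) := T.2
  have hT : 0 < (T : ℝ) := hU.trans_le hUT
  have hG1 : 0 ≤ 8 / U + 32 * U * (1 + 2 * Θ + ν) ^ 2 / X ^ 2 := by positivity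
  have hG2 : 0 ≤ 40 * U / X + 20 * ν * U / (Θ * X) + 288 * U / Θ := by positivity
  rcases le_or_gt (T : ℝ) Θ with hle | hlt
  · have h1 := max_term_le_small (ν := ν) hX hν hU hUT
    have h2 : 32 * U * (1 + 2 * (T : ℝ) + ν) ^ 2 / X ^ 2 ≤ 32 * U * (1 + 2 * Θ + ν) ^ 2 / X ^ 2 := by
      gcongr
    linarith
  · have h1 := max_term_le_large (ν := ν) hX hν hU hUT
    have h2 : 20 * ν * U / ((T : ℝ) * X) ≤ 20 * ν * U / (Θ * X) := by
      refine div_le_div_of_nonneg_left (by positivity) (by positivity) ?_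
      exact mul_le_mul_of_nonneg_right hlt.le hX0.le
    have h3 : 288 * U / (T : ℝ) ≤ 288 * U / Θ :=
      div_le_div_of_nonneg_left (by positivity) hΘ hlt.le
    linarith


/-! ### Numerical bookkeeping for the parameters `X = e^{M¹⁵}`, `ν = M⁴`, `h₁ = X/M⁵`, `h₂ = X/M³` -/

/-- Polynomial domination: `c M^k ≤ X` for `k ≤ 13`, `c ≤ 1024`, when `M ≥ 32` and `X ≥ M¹⁵`. [folklore] -/
theorem const_mul_pow_le {M X : ℝ} (hM : 32 ≤ M) (hX : M ^ 15 + 1 ≤ X) {k : ℕ} (hk : k ≤ 13)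
    {c : ℝ} (hc : c ≤ 1024) : c * M ^ k ≤ X := by
  have hM1 : 1 ≤ M := by linarith
  have hM2 : 1024 ≤ M ^ 2 := by nlinarith
  calc c * M ^ k ≤ 1024 * M ^ k := mul_le_mul_of_nonneg_right hc (by positivity)
    _ ≤ M ^ 2 * M ^ k := mul_le_mul_of_nonneg_right hM2 (by positivity)
    _ = M ^ (k + 2) := by ring
    _ ≤ M ^ 15 := pow_le_pow_right₀ hM1 (by omega)
    _ ≤ X := by linarith

/-- **The left-hand side is at least `1/4`** for `a_m = m^{-iM⁴}`, `h₁ = X/M⁵`, `h₂ = X/M³`,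
`M ≥ 32`, `X ≥ M¹⁵ + 1`. [folklore] -/
theorem lhs_ge_quarter {M X ν h₁ : ℝ} (hM : 32 ≤ M) (hX : M ^ 15 + 1 ≤ X) (hν : ν = M ^ 4)
    (hh₁ : h₁ = X / M ^ 5) :
    1 / 4 ≤ X⁻¹ * ∫ x in X..2 * X, lhsFun ν h₁ (X / M ^ 3) x := by
  have hM1 : 1 ≤ M := by linarith
  have hM0 : 0 < M := by linarith
  have hX1 : 1 ≤ X := by nlinarith [one_le_pow₀ (n := 15) hM1]
  have hX0 : 0 < X := by linarith
  have hν0 : 0 < ν := by rw [hν]; positivity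
  have h5 := const_mul_pow_le hM hX (k := 5) (by norm_num) (c := 1) (by norm_num)
  have h6 := const_mul_pow_le hM hX (k := 6) (by norm_num) (c := 1) (by norm_num)
  have h8 := const_mul_pow_le hM hX (k := 8) (by norm_num) (c := 1) (by norm_num)
  have h3 := const_mul_pow_le hM hX (k := 3) (by norm_num) (c := 1) (by norm_num)
  have hh₁1 : 1 ≤ h₁ := by rw [hh₁, le_div_iff₀ (by positivity)]; linarith
  have hh₁M : M ≤ h₁ := by
    rw [hh₁, le_div_iff₀ (by positivity)]; linarith [show M * M ^ 5 = M ^ 6 by ring]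
  have hh₂1 : 1 ≤ X / M ^ 3 := by rw [le_div_iff₀ (by positivity)]; linarith
  have hh₂X : X / M ^ 3 ≤ X := div_le_self hX0.le (one_le_pow₀ hM1)
  have e1 : ν * h₁ / X = 1 / M := by
    rw [hν, hh₁]; field_simp
  have e2 : (7 * X / ν + (X / M ^ 3 + 1) * ν / X) / (X / M ^ 3)
      = 7 / M + M ^ 4 / X + M ^ 7 / X ^ 2 := by
    rw [hν]; field_simp; ring
  have hsmall : ν * h₁ / X ≤ 1 := by rw [e1, div_le_one hM0]; exact hM1
  refine inv_mul_integral_lhsFun_ge (δ₁ := 2 / M) (δ₂ := 9 / M) hν0 hX1 hh₁1 hh₂1 hh₂X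
    hsmall ?_ ?_ ?_
  · rw [e1]
    have h1 : 1 / h₁ ≤ 1 / M := one_div_le_one_div_of_le hM0 hh₁M
    have h2 : 0 ≤ 1 - 1 / M := by rw [sub_nonneg, div_le_one hM0]; exact hM1
    calc 1 - 2 / M ≤ (1 - 1 / M) * (1 - 1 / M) := by
          have : (1 - 1 / M) * (1 - 1 / M) = 1 - 2 / M + (1 / M) ^ 2 := by ring
          rw [this]; nlinarith [sq_nonneg (1 / M)]
      _ ≤ (1 - 1 / h₁) * (1 - 1 / M) := mul_le_mul_of_nonneg_right (by linarith) h2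
  · rw [e2]
    have h1 : M ^ 4 / X ≤ 1 / M := by
      rw [div_le_div_iff₀ hX0 hM0, one_mul]
      linarith [show M ^ 4 * M = M ^ 5 by ring]
    have h2 : M ^ 7 / X ^ 2 ≤ 1 / M := by
      rw [div_le_div_iff₀ (by positivity) hM0, one_mul]
      have hXX : X ≤ X ^ 2 := by nlinarith
      nlinarith [show M ^ 7 * M = M ^ 8 by ring]
    rw [show (9 : ℝ) / M = 7 / M + 1 / M + 1 / M by ring]
    linarith
  · rw [show 2 / M + 9 / M = 11 / M by ring, div_le_iff₀ hM0]; linarith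

/-- The bound of `integral_term_le` is `≤ 9/M` for `ν = M⁴`, `U = M⁵`, `T₀ = M`. [folklore] -/
theorem integral_bound_le {M X ν U : ℝ} (hM : 32 ≤ M) (hX : M ^ 15 + 1 ≤ X) (hν : ν = M ^ 4)
    (hU : U = M ^ 5) :
    (U - M) * (2 / ν + 4 * (1 + U + ν) / X) ^ 2 ≤ 9 / M := by
  have hM1 : 1 ≤ M := by linarith
  have hM0 : 0 < M := by linarith
  have hX0 : 0 < X := by nlinarith [one_le_pow₀ (n := 15) hM1]
  have hU0 : 0 < U := by rw [hU]; positivity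
  have hν0 : 0 < ν := by rw [hν]; positivity
  have h9 := const_mul_pow_le hM hX (k := 9) (by norm_num) (c := 12) (by norm_num)
  have hB : 2 / ν + 4 * (1 + U + ν) / X ≤ 3 / M ^ 4 := by
    have h9' : 4 * (1 + U + ν) / X ≤ 1 / M ^ 4 := by
      rw [div_le_div_iff₀ hX0 (by positivity), one_mul, hU, hν]
      have m49 : M ^ 4 ≤ M ^ 9 := pow_le_pow_right₀ hM1 (by norm_num)
      have m89 : M ^ 8 ≤ M ^ 9 := pow_le_pow_right₀ hM1 (by norm_num)
      nlinarith [show M ^ 4 * M ^ 4 = M ^ 8 by ring, show M ^ 5 * M ^ 4 = M ^ 9 by ring,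
        one_le_pow₀ (n := 4) hM1]
    rw [hν] at h9' ⊢
    rw [show (3 : ℝ) / M ^ 4 = 2 / M ^ 4 + 1 / M ^ 4 by ring]
    linarith
  have hB0 : 0 ≤ 2 / ν + 4 * (1 + U + ν) / X := by positivity
  have hMU : M ≤ U := by rw [hU]; exact le_self_pow₀ hM1 (by norm_num)
  calc (U - M) * (2 / ν + 4 * (1 + U + ν) / X) ^ 2 ≤ U * (3 / M ^ 4) ^ 2 :=
        mul_le_mul (by linarith) (pow_le_pow_left₀ hB0 hB 2) (sq_nonneg _) hU0.le
    _ = 9 / M ^ 3 := by rw [hU]; field_simp; ring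
    _ ≤ 9 / M := div_le_div_of_nonneg_left (by norm_num) hM0 (le_self_pow₀ hM1 (by norm_num))

/-- The bound of `iSup_max_term_le` is `≤ 12/M` for `ν = M⁴`, `U = M⁵`, `Θ = √X ≥ M¹⁵/2 + 1`. [folklore] -/
theorem max_bound_le {M X ν U Θ : ℝ} (hM : 32 ≤ M) (hX : M ^ 15 + 1 ≤ X) (hν : ν = M ^ 4)
    (hU : U = M ^ 5) (hΘX : Θ ^ 2 = X) (hΘ : M ^ 15 / 2 + 1 ≤ Θ) :
    (8 / U + 32 * U * (1 + 2 * Θ + ν) ^ 2 / X ^ 2)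
      + (40 * U / X + 20 * ν * U / (Θ * X) + 288 * U / Θ) ≤ 12 / M := by
  have hM1 : 1 ≤ M := by linarith
  have hM0 : 0 < M := by linarith
  have hM2 : 1024 ≤ M ^ 2 := by nlinarith
  have hX1 : 1 ≤ X := by nlinarith [one_le_pow₀ (n := 15) hM1]
  have hX0 : 0 < X := by linarith
  have hΘ0 : 0 < Θ := by nlinarith [one_le_pow₀ (n := 15) hM1]
  have hU0 : 0 < U := by rw [hU]; positivity
  have hMU : M ≤ U := by rw [hU]; exact le_self_pow₀ hM1 (by norm_num)
  -- `c M^k ≤ Θ` for `k ≤ 13`, `c ≤ 512`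
  have hdomΘ : ∀ k : ℕ, k ≤ 13 → ∀ c : ℝ, c ≤ 512 → c * M ^ k ≤ Θ := by
    intro k hk c hc
    have : c * M ^ k * 2 ≤ M ^ 15 :=
      calc c * M ^ k * 2 = (2 * c) * M ^ k := by ring
        _ ≤ 1024 * M ^ k := mul_le_mul_of_nonneg_right (by linarith) (by positivity)
        _ ≤ M ^ 2 * M ^ k := mul_le_mul_of_nonneg_right hM2 (by positivity)
        _ = M ^ (k + 2) := by ring
        _ ≤ M ^ 15 := pow_le_pow_right₀ hM1 (by omega)
    linarith
  have t1 : 8 / U ≤ 8 / M := div_le_div_of_nonneg_left (by norm_num) hM0 hMU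
  have t2 : 32 * U * (1 + 2 * Θ + ν) ^ 2 / X ^ 2 ≤ 1 / M := by
    have hsq : (1 + 2 * Θ + ν) ^ 2 ≤ 9 * X := by
      have hν0 : 0 ≤ ν := by rw [hν]; positivity
      have hνΘ : 1 + ν ≤ Θ := by
        have := hdomΘ 4 (by norm_num) 2 (by norm_num)
        rw [hν]; nlinarith [one_le_pow₀ (n := 4) hM1]
      have h0 : 0 ≤ 1 + 2 * Θ + ν := by linarith
      calc (1 + 2 * Θ + ν) ^ 2 ≤ (3 * Θ) ^ 2 := pow_le_pow_left₀ h0 (by linarith) 2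
        _ = 9 * X := by rw [← hΘX]; ring
    calc 32 * U * (1 + 2 * Θ + ν) ^ 2 / X ^ 2 ≤ 32 * U * (9 * X) / X ^ 2 := by gcongr
      _ = 288 * M ^ 5 / X := by rw [hU]; field_simp; ring
      _ ≤ 1 / M := by
          rw [div_le_div_iff₀ hX0 hM0, one_mul]
          have := const_mul_pow_le hM hX (k := 6) (by norm_num) (c := 288) (by norm_num)
          linarith [show 288 * M ^ 5 * M = 288 * M ^ 6 by ring]
  have t3 : 40 * U / X ≤ 1 / M := by
    rw [div_le_div_iff₀ hX0 hM0, one_mul, hU]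
    have := const_mul_pow_le hM hX (k := 6) (by norm_num) (c := 40) (by norm_num)
    linarith [show 40 * M ^ 5 * M = 40 * M ^ 6 by ring]
  have t4 : 20 * ν * U / (Θ * X) ≤ 1 / M := by
    rw [div_le_div_iff₀ (by positivity) hM0, one_mul, hU, hν]
    have h10 := hdomΘ 10 (by norm_num) 20 (by norm_num)
    have : Θ ≤ Θ * X := le_mul_of_one_le_right hΘ0.le hX1
    nlinarith [show 20 * M ^ 4 * M ^ 5 * M = 20 * M ^ 10 by ring]
  have t5 : 288 * U / Θ ≤ 1 / M := by
    rw [div_le_div_iff₀ hΘ0 hM0, one_mul, hU]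
    have := hdomΘ 6 (by norm_num) 288 (by norm_num)
    linarith [show 288 * M ^ 5 * M = 288 * M ^ 6 by ring]
  rw [show (12 : ℝ) / M = 8 / M + 1 / M + 1 / M + 1 / M + 1 / M by ring]
  linarith

end MatomakiRadziwillL14C

-- `MatomakiRadziwill2016_lemma14_parseval` is `@[deprecated]` (refuted here; 2026-08-15) and its refutation must
-- name it; REMOVE-WHEN the deprecated def is deleted from `MatomakiRadziwill.lean`.
set_option linter.deprecated false in
open MatomakiRadziwillL14C in
/-- **The complex-sequence rendering `MatomakiRadziwill2016_lemma14_parseval` of Lemma 14 is false.**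

Matomäki–Radziwiłł's Lemma 14 ("Let `|a_m| ≤ 1` …") is stated and proved for a real sequence: its
proof splits the Perron integral according to whether `|t| ≤ T₀` "or not" and then displays only the
range `t ≥ T₀`, which uses `|A(1-it)| = |A(1+it)|`.  The Literature rendering
`MatomakiRadziwill2016_lemma14_parseval` quantifies over `a : ℕ → ℂ`, and for complex sequences the
one-sided right-hand side does not control the left-hand side.  Counterexample (with `M → ∞`):
`X = exp(M¹⁵)` (so `(log X)^{1/15} = M`, `(log X)^{1/5} = M³`, `(log X)^{2/15} = M²`),
`a_m = m^{-iM⁴}`, `h₁ = X/M⁵`.  Then `A(1+it) = D(t + M⁴)` with `D(u) = ∑_{X≤m≤4X} m^{-1-iu}`,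
`|D(u)| ≤ 2/u + 4(1+u)/X` (`norm_Dsum_le`), so the integral term is `≤ 9/M`; the `max` term is
`≤ 12/M` (pointwise for `T ≤ √X`, the weak mean value theorem `dirichletPolynomial_meanSquare_le`
for `T ≥ √X`); while `|S₁(x)|/h₁ ≥ 1 - 2/M` (the phase `m^{-iM⁴}` is nearly constant on
`[x, x+h₁]`) and `|S₂(x)|/h₂ ≤ 9/M` (cancellation over `[x, x+h₂]`, `h₂ = X/M³`), so the left-hand
side is `≥ 1/4`, while the right-hand side is `≤ 22 C/M`.  Hence no constants `C, X₀` work.  The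
faithful (real-sequence) rendering `MatomakiRadziwill2016_lemma14_real` is proved in
`MatomakiRadziwillLemma14.lean`. [cite: MatomakiRadziwillAnnals2016, Lemma 14] -/
theorem MatomakiRadziwill2016_lemma14_parseval_false : ¬ MatomakiRadziwill2016_lemma14_parseval := by
  rintro ⟨C, X₀, H⟩
  /- parameters: `C₁ = max(C, 1)`, `M = max(32, X₀, 100 C₁)` -/
  obtain ⟨C₁, hC₁1, hCC₁⟩ : ∃ C₁ : ℝ, 1 ≤ C₁ ∧ C ≤ C₁ := ⟨max C 1, le_max_right _ _, le_max_left _ _⟩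
  obtain ⟨M, hM32, hMX₀, hMC⟩ : ∃ M : ℝ, 32 ≤ M ∧ X₀ ≤ M ∧ 100 * C₁ ≤ M :=
    ⟨max 32 (max X₀ (100 * C₁)), le_max_left _ _, (le_max_left _ _).trans (le_max_right _ _),
      (le_max_right _ _).trans (le_max_right _ _)⟩
  have hM1 : 1 ≤ M := by linarith
  have hM0 : 0 < M := by linarith
  /- `L = M¹⁵ = log X`, `X = e^L`, `Θ = √X` -/
  obtain ⟨L, hL⟩ : ∃ L : ℝ, L = M ^ 15 := ⟨_, rfl⟩
  obtain ⟨X, hXdef⟩ : ∃ X : ℝ, X = Real.exp L := ⟨_, rfl⟩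
  have hX15 : M ^ 15 + 1 ≤ X := by rw [hXdef, ← hL]; exact Real.add_one_le_exp L
  have hL0 : 0 ≤ L := by rw [hL]; positivity
  have hML : M ≤ M ^ 15 := le_self_pow₀ hM1 (by norm_num)
  have hX1 : 1 ≤ X := by linarith
  have hX0 : 0 < X := by linarith
  have hlog : Real.log X = L := by rw [hXdef, Real.log_exp]
  obtain ⟨Θ, hΘ⟩ : ∃ Θ : ℝ, Θ = Real.exp (L / 2) := ⟨_, rfl⟩
  have hΘ0 : 0 < Θ := by rw [hΘ]; exact Real.exp_pos _
  have hΘX : Θ ^ 2 = X := by rw [hΘ, hXdef, sq, ← Real.exp_add]; ring_nf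
  have hΘL : M ^ 15 / 2 + 1 ≤ Θ := by rw [hΘ, ← hL]; exact Real.add_one_le_exp _
  /- the exponents of `log X = M¹⁵` -/
  have hr15 : L ^ (1 / 15 : ℝ) = M := by
    rw [hL, show (1 / 15 : ℝ) = ((15 : ℕ) : ℝ)⁻¹ by norm_num]
    exact Real.pow_rpow_inv_natCast hM0.le (by norm_num)
  have hr5 : L ^ (1 / 5 : ℝ) = M ^ 3 := by
    rw [hL, show M ^ 15 = (M ^ 3) ^ 5 by ring, show (1 / 5 : ℝ) = ((5 : ℕ) : ℝ)⁻¹ by norm_num]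
    exact Real.pow_rpow_inv_natCast (by positivity) (by norm_num)
  have hr215 : L ^ (2 / 15 : ℝ) = M ^ 2 := by
    rw [show (2 / 15 : ℝ) = (1 / 15 : ℝ) * 2 by norm_num, Real.rpow_mul hL0, hr15, Real.rpow_two]
  /- `ν = M⁴`, `h₁ = X/M⁵` (`X/h₁ = M⁵`) -/
  obtain ⟨ν, hν⟩ : ∃ ν : ℝ, ν = M ^ 4 := ⟨_, rfl⟩
  obtain ⟨h₁, hh₁⟩ : ∃ h₁ : ℝ, h₁ = X / M ^ 5 := ⟨_, rfl⟩
  have hν0 : 0 < ν := by rw [hν]; positivity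
  have hU : X / h₁ = M ^ 5 := by
    rw [hh₁]; field_simp
  have hU0 : 0 < X / h₁ := by rw [hU]; positivity
  have hMU : M ≤ X / h₁ := by rw [hU]; exact le_self_pow₀ hM1 (by norm_num)
  have hh₁0 : 0 < h₁ := by rw [hh₁]; positivity
  have h5X : M ^ 5 ≤ X := (pow_le_pow_right₀ hM1 (by norm_num : 5 ≤ 15)).trans (by linarith)
  have hh₁1 : 1 ≤ h₁ := by rw [hh₁, le_div_iff₀ (by positivity)]; linarith
  have hh₁2 : h₁ ≤ X / Real.log X ^ (1 / 5 : ℝ) := by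
    rw [hlog, hr5, hh₁]
    exact div_le_div_of_nonneg_left hX0.le (by positivity) (pow_le_pow_right₀ hM1 (by norm_num))
  have hXX₀ : X₀ ≤ X := by linarith
  /- the instance of the (false) lemma -/
  have key := H (twist ν) (norm_twist_le_one ν) X h₁ hXX₀ hh₁1 hh₁2
  simp only [hlog, hr15, hr215, hr5, sum_twist_mul_cpow hX0] at key
  change X⁻¹ * ∫ x in X..2 * X, lhsFun ν h₁ (X / M ^ 3) x ≤ _ at key
  /- the three estimates -/
  have hLHS := lhs_ge_quarter hM32 hX15 hν hh₁
  have hI := (integral_term_le (X := X) (ν := ν) (T₀ := M) (U := X / h₁) hX1 hν0 hM0.le hMU).trans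
    (integral_bound_le hM32 hX15 hν hU)
  have hS := (iSup_max_term_le (X := X) (ν := ν) (U := X / h₁) (Θ := Θ) hX1 hν0.le hU0 hΘ0).trans
    (max_bound_le hM32 hX15 hν hU hΘX hΘL)
  /- assembly -/
  have hI0 : 0 ≤ ∫ t in M..X / h₁, ‖Dsum X (t + ν)‖ ^ 2 :=
    intervalIntegral.integral_nonneg hMU fun t _ => sq_nonneg _
  have hS0 : 0 ≤ ⨆ T : Set.Ici (X / h₁), X / h₁ / (T : ℝ) * ∫ t in (T : ℝ)..2 * T, ‖Dsum X (t + ν)‖ ^ 2 := by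
    refine Real.iSup_nonneg fun T => ?_
    have hT0 : 0 < (T : ℝ) := hU0.trans_le T.2
    exact mul_nonneg (div_nonneg hU0.le hT0.le)
      (intervalIntegral.integral_nonneg (by linarith) fun t _ => sq_nonneg _)
  have hM2' : 1 / M ^ 2 ≤ 1 / M := div_le_div_of_nonneg_left (by norm_num) hM0 (by nlinarith)
  have hM2'' : 0 ≤ 1 / M ^ 2 := by positivity
  have hfin : C₁ * (22 / M) < 1 / 4 := by
    rw [show C₁ * (22 / M) = 22 * C₁ / M by ring, div_lt_iff₀ hM0]
    nlinarith
  have h1 := key.trans (mul_le_mul_of_nonneg_right hCC₁ (by linarith))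
  have h2 : C₁ * (1 / M ^ 2 + (∫ t in M..X / h₁, ‖Dsum X (t + ν)‖ ^ 2)
      + ⨆ T : Set.Ici (X / h₁), X / h₁ / (T : ℝ) * ∫ t in (T : ℝ)..2 * T, ‖Dsum X (t + ν)‖ ^ 2)
        ≤ C₁ * (22 / M) := by
    refine mul_le_mul_of_nonneg_left ?_ (by linarith)
    rw [show (22 : ℝ) / M = 1 / M + 9 / M + 12 / M by ring]
    linarith
  linarith

-- the alias must name the deprecated def too; REMOVE-WHEN the deprecated def is deleted.
set_option linter.deprecated false in
/-- Conventional name (`not_<decl>`) of the refutation of the deprecated named fact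
`MatomakiRadziwill2016_lemma14_parseval` (= `MatomakiRadziwill2016_lemma14_parseval_false`).
[cite: MatomakiRadziwillAnnals2016, Lemma 14] -/
theorem not_MatomakiRadziwill2016_lemma14_parseval : ¬ MatomakiRadziwill2016_lemma14_parseval :=
  MatomakiRadziwill2016_lemma14_parseval_false

end Literature.NumberTheory.Sieve
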